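import Summits.QuantumFields.QCD.Theorems.EulerDescentChiralCornerSoftnessStubSlabFluxBoundWardOp
import HarnessLib

/-!
# The commutator of the twisted Wilson–Dirac matrix with a time-sliced flavour rotation (file 3/4 of stub
`stub_slabFluxBound`, line `Sketch` of crux `Summit.QuantumFields.QCD.Theses.EulerDescent.ChiralCornerSoftness`,
item stmt-QuantumFields-16902)

The two divergence identities behind the PCVC relation of twisted-mass Wilson quarks, for the matrices of the
doublet `(f,g)` on quark variables defined in `EulerDescentChiralCornerSoftnessStubSlabFluxBoundBerezin.lean`
(`tau1M`, `tau2M`, `twSign`, `flavDiag`, `diracQ`, `twistQ`, `twistBlock`, `rotQ`, `densQ`, `currQ`):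

* the flavour algebra `τ²_{f₁g₁}(s_{f₁} − s_{g₁}) = −2iτ¹_{f₁g₁}` (`[τ³,τ²] = −2iτ¹`, `tau2M_mul_twSign_sub`) and
  the entries of the kernels and of products with the rotation generator `rotQ f g b = b(x₀) τ²`;
* **(MI-a)** `[D_W(U,m₀), B_b] = Σ_x (b(x₀+1) − b(x₀)) · currQ x` (`diracQ_comm_rotQ`): the mass term and the
  spatial hops commute with the rotation, the temporal hops differentiate the angle across the link — for EVERY
  torus side and every `b`;
* **(MI-b)** `[iμγ₅τ³, B_b] = 2μ Σ_x b(x₀) · densQ x` (`twistQ_comm_rotQ`, `f ≠ g`);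
* `P¹(0)` is not rotated when `b(0) = 0` (`densQ_zero_mul_rotQ`, `rotQ_mul_densQ_zero`).

References: I. Montvay, G. Münster, *Quantum Fields on a Lattice* (1994), §5.3.1 (5.149)–(5.150), §4.4.2
(4.254)–(4.255); R. Frezzotti, P. A. Grassi, S. Sint, P. Weisz, JHEP 08 (2001) 058, §2.1.  Everything is
proved; no named fact.
-/

noncomputable section

namespace Summit.QuantumFields.QCD.Cruxes.ChiralCornerSoftness.TwistedRay

open Filter Topology MeasureTheory
open Literature.MathematicalPhysics.QuantumFieldTheory Literature.MathematicalPhysics.QuantumLattice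
  Literature.Probability.LatticeModels

namespace SlabFluxWard

open Literature.MathematicalPhysics.QuantumLattice.GrassmannAlgebra

/-! ### §C The matrices of the twisted doublet and the commutator (divergence) identities -/

section Matrices

variable {Nf L : ℕ} [NeZero L]

/-- **Flavour algebra of the doublet**: `τ²_{f₁g₁} (s_{f₁} − s_{g₁}) = −2i τ¹_{f₁g₁}`, i.e.
`[τ³, τ²] = −2iτ¹` entrywise (`f ≠ g`). [folklore] -/
theorem tau2M_mul_twSign_sub {f g : Fin Nf} (hfg : f ≠ g) (f₁ g₁ : Fin Nf) :
    tau2M f g f₁ g₁ * (twSign f g f₁ - twSign f g g₁) = -2 * Complex.I * tau1M f g f₁ g₁ := by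
  simp only [tau2M, tau1M, twSign, Matrix.add_apply, Matrix.smul_apply, Matrix.single, Matrix.of_apply,
    smul_eq_mul]
  by_cases h1 : f₁ = f
  · subst h1
    by_cases h2 : g₁ = g
    · subst h2; simp [hfg, Ne.symm hfg]; ring
    · simp [Ne.symm hfg, h2, Ne.symm h2]
  · by_cases h3 : f₁ = g
    · subst h3
      by_cases h4 : g₁ = f
      · subst h4; simp [hfg, Ne.symm hfg]; ring
      · simp [hfg, Ne.symm hfg, h4, Ne.symm h4]
    · simp [h1, h3, Ne.symm h1, Ne.symm h3]

/-- `diracMatrix` at degenerate mass is the enumeration of `diracQ`. [folklore] -/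
theorem diracMatrix_eq_reindex_diracQ (U : GaugeConfig 4 L (Matrix.specialUnitaryGroup (Fin 3) ℂ)) (m₀ : ℝ) :
    diracMatrix U (fun _ : Fin Nf => m₀) = Matrix.reindex quarkEquiv quarkEquiv (diracQ U m₀) := rfl

omit [NeZero L] in
/-- The twisted mass is flavour-diagonal with blocks `s_{f'} · iμγ₅`. [folklore] -/
theorem twistQ_eq_flavDiag (f g : Fin Nf) (μl : ℝ) :
    twistQ (L := L) f g μl = flavDiag fun f' => twSign f g f' • twistBlock μl := by
  ext v w
  simp only [twistQ, flavDiag, twistBlock, twSign, Matrix.of_apply, Matrix.smul_apply, smul_eq_mul]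
  by_cases h : v.1 = w.1
  · simp only [h, true_and, if_true]
    split_ifs <;> ring
  · simp [h]

/-! #### Entries -/

omit [NeZero L] in
/-- Entries of a flavour-summed bilinear kernel. [folklore] -/
theorem sum_sum_smul_bilinKernel_apply (T : Matrix (Fin Nf) (Fin Nf) ℂ) (x y : TorusSite 4 L)
    (Γs : Matrix (Fin 4) (Fin 4) ℂ) (Mc : Matrix (Fin 3) (Fin 3) ℂ) (v w : QuarkVar Nf L) :
    (∑ f', ∑ g', T f' g' • bilinKernel f' g' x y Γs Mc) v w =
      if v.2.1 = x ∧ w.2.1 = y then T v.1 w.1 * (Γs v.2.2.2 w.2.2.2 * Mc v.2.2.1 w.2.2.1) else 0 := by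
  simp only [Matrix.sum_apply, Matrix.smul_apply, bilinKernel, Matrix.of_apply, smul_eq_mul]
  rw [Finset.sum_eq_single v.1 (fun f' _ hf' => by simp [Ne.symm hf']) (fun h => absurd (Finset.mem_univ _) h),
    Finset.sum_eq_single w.1 (fun g' _ hg' => by simp [Ne.symm hg']) (fun h => absurd (Finset.mem_univ _) h)]
  by_cases hx : v.2.1 = x
  · by_cases hy : w.2.1 = y
    · simp [hx, hy]
    · simp [hy]
  · simp [hx]

omit [NeZero L] in
/-- Entries of the density kernel. [folklore] -/
theorem densQ_apply (f g : Fin Nf) (x : TorusSite 4 L) (v w : QuarkVar Nf L) :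
    densQ f g x v w =
      if v.2.1 = x ∧ w.2.1 = x then
        tau1M f g v.1 w.1 * (gammaFive v.2.2.2 w.2.2.2 * (1 : Matrix (Fin 3) (Fin 3) ℂ) v.2.2.1 w.2.2.1)
      else 0 :=
  sum_sum_smul_bilinKernel_apply _ _ _ _ _ v w

omit [NeZero L] in
/-- Entries of the current kernel. [folklore] -/
theorem currQ_apply (f g : Fin Nf) (U : GaugeConfig 4 L (Matrix.specialUnitaryGroup (Fin 3) ℂ)) (x : TorusSite 4 L) (v w : QuarkVar Nf L) :
    currQ f g U x v w =
      (1 / 2 : ℂ) *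
        ((if v.2.1 = x + Pi.single 0 1 ∧ w.2.1 = x then
            tau2M f g v.1 w.1 *
              ((1 + euclideanGamma 0) v.2.2.2 w.2.2.2 *
                (((U (x, 0))⁻¹ : Matrix.specialUnitaryGroup (Fin 3) ℂ) : Matrix (Fin 3) (Fin 3) ℂ) v.2.2.1 w.2.2.1)
          else 0) -
          (if v.2.1 = x ∧ w.2.1 = x + Pi.single 0 1 then
            tau2M f g v.1 w.1 *
              ((1 - euclideanGamma 0) v.2.2.2 w.2.2.2 * ((U (x, 0) : Matrix.specialUnitaryGroup (Fin 3) ℂ) : Matrix (Fin 3) (Fin 3) ℂ) v.2.2.1 w.2.2.1)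
          else 0)) := by
  rw [currQ, Matrix.smul_apply, Matrix.sub_apply, sum_sum_smul_bilinKernel_apply, sum_sum_smul_bilinKernel_apply,
    smul_eq_mul]

/-- Right multiplication by the rotation generator, entrywise. [folklore] -/
theorem mul_rotQ_apply (f g : Fin Nf) (b : ZMod L → ℂ) (M : Matrix (QuarkVar Nf L) (QuarkVar Nf L) ℂ)
    (v w : QuarkVar Nf L) :
    (M * rotQ f g b) v w = ∑ u₁ : Fin Nf, M v (u₁, w.2) * (b (w.2.1 0) * tau2M f g u₁ w.1) := by
  rw [Matrix.mul_apply, Fintype.sum_prod_type]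
  refine Finset.sum_congr rfl fun u₁ _ => ?_
  rw [Fintype.sum_eq_single w.2 (fun u₂ hu₂ => by simp [rotQ, hu₂])]
  simp [rotQ]

/-- Left multiplication by the rotation generator, entrywise. [folklore] -/
theorem rotQ_mul_apply (f g : Fin Nf) (b : ZMod L → ℂ) (M : Matrix (QuarkVar Nf L) (QuarkVar Nf L) ℂ)
    (v w : QuarkVar Nf L) :
    (rotQ f g b * M) v w = ∑ u₁ : Fin Nf, (b (v.2.1 0) * tau2M f g v.1 u₁) * M (u₁, v.2) w := by
  rw [Matrix.mul_apply, Fintype.sum_prod_type]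
  refine Finset.sum_congr rfl fun u₁ _ => ?_
  rw [Fintype.sum_eq_single v.2 (fun u₂ hu₂ => by simp [rotQ, Ne.symm hu₂])]
  simp [rotQ]

/-- **The commutator of a flavour-diagonal matrix with the rotation generator**, entrywise. [folklore] -/
theorem flavDiag_comm_rotQ_apply (F : Fin Nf → Matrix (TorusSite 4 L × Fin 3 × Fin 4) (TorusSite 4 L × Fin 3 × Fin 4) ℂ)
    (f g : Fin Nf) (b : ZMod L → ℂ) (v w : QuarkVar Nf L) :
    (flavDiag F * rotQ f g b - rotQ f g b * flavDiag F) v w =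
      tau2M f g v.1 w.1 * (b (w.2.1 0) * F v.1 v.2 w.2 - b (v.2.1 0) * F w.1 v.2 w.2) := by
  rw [Matrix.sub_apply, mul_rotQ_apply, rotQ_mul_apply,
    Finset.sum_eq_single v.1 (fun u₁ _ hu₁ => by simp [flavDiag, Ne.symm hu₁]) (fun h => absurd (Finset.mem_univ _) h),
    Finset.sum_eq_single w.1 (fun u₁ _ hu₁ => by simp [flavDiag, hu₁]) (fun h => absurd (Finset.mem_univ _) h)]
  simp only [flavDiag, Matrix.of_apply, if_true]
  ring

/-! #### The twisted-mass commutator: `[iμγ₅τ³, B_b] = 2μ b(x₀) γ₅ τ¹` -/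

/-- **(MI-b)** `[Tw, B_b] = 2μ Σ_x b(x₀) · (kernel of P¹(x))`. [folklore] -/
theorem twistQ_comm_rotQ {f g : Fin Nf} (hfg : f ≠ g) (μl : ℝ) (b : ZMod L → ℂ) :
    twistQ (L := L) f g μl * rotQ f g b - rotQ f g b * twistQ f g μl =
      (2 * (μl : ℂ)) • ∑ x : TorusSite 4 L, b (x 0) • densQ f g x := by
  ext v w
  rw [twistQ_eq_flavDiag, flavDiag_comm_rotQ_apply]
  simp only [Matrix.smul_apply, Matrix.sum_apply, smul_eq_mul, densQ_apply, twistBlock, Matrix.of_apply,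
    Matrix.one_apply]
  rw [Finset.sum_eq_single v.2.1 (fun x _ hx => by simp [Ne.symm hx]) (fun h => absurd (Finset.mem_univ _) h)]
  by_cases hx : v.2.1 = w.2.1
  · by_cases hc : v.2.2.1 = w.2.2.1
    · simp only [hx, hc, and_self, if_true, mul_one]
      have key := tau2M_mul_twSign_sub hfg v.1 w.1
      linear_combination (b (w.2.1 0) * (↑μl * Complex.I) * gammaFive v.2.2.2 w.2.2.2) * key
        + (-2 * ↑μl * b (w.2.1 0) * tau1M f g v.1 w.1 * gammaFive v.2.2.2 w.2.2.2) * Complex.I_sq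
    · simp [hx, hc]
  · simp [hx, Ne.symm hx]

/-! #### The Wilson–Dirac commutator: minus the backward divergence of the conserved current -/

omit [NeZero L] in
/-- The mass term is site-diagonal: it does not see the rotation. [folklore] -/
theorem sub_mul_ite_eq_zero (b : ZMod L → ℂ) (p q : TorusSite 4 L × Fin 3 × Fin 4) (M : ℂ) :
    (b (q.1 0) - b (p.1 0)) * (if p = q then M else 0) = 0 := by
  split_ifs with h
  · rw [h, sub_self, zero_mul]
  · rw [mul_zero]

omit [NeZero L] in
/-- Spatial hops do not change the time coordinate: their contribution to `[D, B_b]` vanishes. [folklore] -/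
theorem sub_mul_hop_of_ne (b : ZMod L → ℂ) (p q : TorusSite 4 L × Fin 3 × Fin 4) {μ : Fin 4} (hμ : μ ≠ 0)
    (X Y : ℂ) :
    (b (q.1 0) - b (p.1 0)) *
        ((if q.1 = p.1 + Pi.single μ 1 then X else 0) + (if p.1 = q.1 + Pi.single μ 1 then Y else 0)) = 0 := by
  have h0 : (Pi.single μ (1 : ZMod L) : TorusSite 4 L) 0 = 0 := Pi.single_eq_of_ne (Ne.symm hμ) _
  split_ifs with h1 h2 h2
  · have : q.1 0 = p.1 0 := by rw [h1, Pi.add_apply, h0, add_zero]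
    rw [this, sub_self, zero_mul]
  · have : q.1 0 = p.1 0 := by rw [h1, Pi.add_apply, h0, add_zero]
    rw [this, sub_self, zero_mul]
  · have : p.1 0 = q.1 0 := by rw [h2, Pi.add_apply, h0, add_zero]
    rw [this, sub_self, zero_mul]
  · rw [add_zero, mul_zero]

omit [NeZero L] in
/-- The temporal hops: the time-dependent rotation angle differentiates across the link. [folklore] -/
theorem sub_mul_hop_zero (b : ZMod L → ℂ) (p q : TorusSite 4 L × Fin 3 × Fin 4) (X Y : ℂ) :
    (b (q.1 0) - b (p.1 0)) *
        ((if q.1 = p.1 + Pi.single 0 1 then X else 0) + (if p.1 = q.1 + Pi.single 0 1 then Y else 0)) =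
      (if q.1 = p.1 + Pi.single 0 1 then (b (p.1 0 + 1) - b (p.1 0)) * X else 0) -
        (if p.1 = q.1 + Pi.single 0 1 then (b (q.1 0 + 1) - b (q.1 0)) * Y else 0) := by
  have e : ∀ {x y : TorusSite 4 L}, y = x + Pi.single 0 1 → y 0 = x 0 + 1 := fun h => by
    rw [h, Pi.add_apply, Pi.single_eq_same]
  split_ifs with h1 h2 h2
  · rw [← congrArg b (e h1), ← congrArg b (e h2)]; ring
  · rw [← congrArg b (e h1)]; ring
  · rw [← congrArg b (e h2)]; ring
  · ring

omit [NeZero L] in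
/-- **The time-sliced rotation differentiates the Wilson–Dirac matrix only across temporal links.** [folklore] -/
theorem sub_mul_wilsonDirac (U : GaugeConfig 4 L (Matrix.specialUnitaryGroup (Fin 3) ℂ)) (m₀ : ℝ) (b : ZMod L → ℂ) (p q : TorusSite 4 L × Fin 3 × Fin 4) :
    (b (q.1 0) - b (p.1 0)) * wilsonDirac (fundamentalRep (Fin 3)) U m₀ 1 p q =
      -(1 / 2 : ℂ) *
        ((if q.1 = p.1 + Pi.single 0 1 then
            (b (p.1 0 + 1) - b (p.1 0)) *
              ((1 - euclideanGamma 0) p.2.2 q.2.2 * ((U (p.1, 0) : Matrix.specialUnitaryGroup (Fin 3) ℂ) : Matrix (Fin 3) (Fin 3) ℂ) p.2.1 q.2.1)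
          else 0) -
          (if p.1 = q.1 + Pi.single 0 1 then
            (b (q.1 0 + 1) - b (q.1 0)) *
              ((1 + euclideanGamma 0) p.2.2 q.2.2 * (((U (q.1, 0))⁻¹ : Matrix.specialUnitaryGroup (Fin 3) ℂ) : Matrix (Fin 3) (Fin 3) ℂ) p.2.1 q.2.1)
          else 0)) := by
  rw [wilsonDirac, Matrix.of_apply, mul_sub, sub_mul_ite_eq_zero, zero_sub, mul_left_comm, Finset.mul_sum,
    Fin.sum_univ_four]
  simp only [Literature.MathematicalPhysics.QuantumFieldTheory.Site.shift, fundamentalRep_apply,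
    Complex.ofReal_one, one_smul]
  rw [sub_mul_hop_zero, sub_mul_hop_of_ne b p q (μ := 1) (by decide), sub_mul_hop_of_ne b p q (μ := 2) (by decide),
    sub_mul_hop_of_ne b p q (μ := 3) (by decide)]
  ring

omit [NeZero L] in
/-- Sum bookkeeping. [folklore] -/
theorem sum_mul_mul_sub {X : Type*} [Fintype X] (c I₁ I₂ : X → ℂ) (k : ℂ) :
    ∑ x, c x * (k * (I₁ x - I₂ x)) = k * ((∑ x, c x * I₁ x) - ∑ x, c x * I₂ x) := by
  simp only [mul_sub, Finset.sum_sub_distrib, Finset.mul_sum]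
  congr 1 <;> exact Finset.sum_congr rfl fun x _ => by ring

omit [NeZero L] in
/-- Collapsing a sum on a Kronecker delta (right conjunct). [folklore] -/
theorem sum_mul_ite_and_right {X : Type*} [Fintype X] [DecidableEq X] (c A : X → ℂ) (P : X → Prop)
    [DecidablePred P] (y : X) : ∑ x, c x * (if P x ∧ y = x then A x else 0) = if P y then c y * A y else 0 := by
  rw [Finset.sum_eq_single y (fun x _ hx => by simp [Ne.symm hx]) (fun h => absurd (Finset.mem_univ _) h)]
  by_cases hP : P y <;> simp [hP]

omit [NeZero L] in
/-- Collapsing a sum on a Kronecker delta (left conjunct). [folklore] -/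
theorem sum_mul_ite_and_left {X : Type*} [Fintype X] [DecidableEq X] (c A : X → ℂ) (P : X → Prop)
    [DecidablePred P] (y : X) : ∑ x, c x * (if y = x ∧ P x then A x else 0) = if P y then c y * A y else 0 := by
  rw [Finset.sum_eq_single y (fun x _ hx => by simp [Ne.symm hx]) (fun h => absurd (Finset.mem_univ _) h)]
  by_cases hP : P y <;> simp [hP]

/-- **(MI-a)** `[D_W(U, m₀), B_b] = Σ_x (b(x₀+1) − b(x₀)) · (kernel of Ṽ²₀(x))`: an exact symmetry of the
Wilson term is broken only by the time dependence of the rotation angle, across temporal links. [folklore] -/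
theorem diracQ_comm_rotQ (U : GaugeConfig 4 L (Matrix.specialUnitaryGroup (Fin 3) ℂ)) (m₀ : ℝ) (f g : Fin Nf) (b : ZMod L → ℂ) :
    diracQ U m₀ * rotQ f g b - rotQ f g b * diracQ (Nf := Nf) U m₀ =
      ∑ x : TorusSite 4 L, (b (x 0 + 1) - b (x 0)) • currQ f g U x := by
  ext v w
  rw [diracQ, flavDiag_comm_rotQ_apply, Matrix.sum_apply]
  simp only [Matrix.smul_apply, smul_eq_mul, currQ_apply]
  rw [show b (w.2.1 0) * wilsonDirac (fundamentalRep (Fin 3)) U m₀ 1 v.2 w.2 -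
      b (v.2.1 0) * wilsonDirac (fundamentalRep (Fin 3)) U m₀ 1 v.2 w.2 =
      (b (w.2.1 0) - b (v.2.1 0)) * wilsonDirac (fundamentalRep (Fin 3)) U m₀ 1 v.2 w.2 by ring,
    sub_mul_wilsonDirac, sum_mul_mul_sub, sum_mul_ite_and_right, sum_mul_ite_and_left]
  split_ifs <;> ring

/-- **The full commutator of the twisted Dirac matrix with the time-sliced flavour rotation.** [folklore] -/
theorem twDirac_comm_rotQ {f g : Fin Nf} (hfg : f ≠ g) (U : GaugeConfig 4 L (Matrix.specialUnitaryGroup (Fin 3) ℂ)) (m₀ μl : ℝ) (b : ZMod L → ℂ) :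
    (diracQ U m₀ + twistQ f g μl) * rotQ f g b - rotQ f g b * (diracQ U m₀ + twistQ f g μl) =
      ∑ x : TorusSite 4 L, (b (x 0 + 1) - b (x 0)) • currQ f g U x +
        (2 * (μl : ℂ)) • ∑ x : TorusSite 4 L, b (x 0) • densQ f g x := by
  rw [Matrix.add_mul, Matrix.mul_add, add_sub_add_comm, diracQ_comm_rotQ, twistQ_comm_rotQ hfg]

/-! #### The density at the origin is not rotated when `b(0) = 0` -/

/-- `ker P¹(0) · B_b = 0` when `b(0) = 0`. [folklore] -/
theorem densQ_zero_mul_rotQ (f g : Fin Nf) {b : ZMod L → ℂ} (hb : b 0 = 0) :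
    densQ f g (0 : TorusSite 4 L) * rotQ f g b = 0 := by
  ext v w
  rw [mul_rotQ_apply, Matrix.zero_apply]
  refine Finset.sum_eq_zero fun u₁ _ => ?_
  rw [densQ_apply]
  by_cases hw : w.2.1 = 0
  · simp [hw, hb]
  · simp [hw]

/-- `B_b · ker P¹(0) = 0` when `b(0) = 0`. [folklore] -/
theorem rotQ_mul_densQ_zero (f g : Fin Nf) {b : ZMod L → ℂ} (hb : b 0 = 0) :
    rotQ f g b * densQ f g (0 : TorusSite 4 L) = 0 := by
  ext v w
  rw [rotQ_mul_apply, Matrix.zero_apply]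
  refine Finset.sum_eq_zero fun u₁ _ => ?_
  rw [densQ_apply]
  by_cases hv : v.2.1 = 0
  · simp [hv, hb]
  · simp [hv]


end Matrices

end SlabFluxWard

/-- **Registered sub-goal of file 3/4** (`stub_slabFluxBound_commutator`): the commutator of the twisted-mass
`N_f`-flavour Wilson–Dirac matrix with the time-sliced flavour rotation `B_b = b(x₀)τ²` is the discrete time
derivative of `b` times the kernel of the conserved point-split current `Ṽ²₀` plus `2μ b` times the kernel of the
charged density `P¹` — the matrix form of the PCVC relation `∂*_μ Ṽ²_μ = −2μ P¹` of twisted-mass Wilson quarks.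
[cite: FrezzottiGrassiSintWeisz2001, §2.1] [cite: MontvayMunster1994, §5.3.1 (5.149)–(5.150)] -/
theorem stub_slabFluxBound_commutator :
    ∀ {Nf L : ℕ} [NeZero L] {f g : Fin Nf}, f ≠ g → ∀ (U : GaugeConfig 4 L (Matrix.specialUnitaryGroup (Fin 3) ℂ)) (m₀ μl : ℝ) (b : ZMod L → ℂ), (SlabFluxWard.diracQ U m₀ + SlabFluxWard.twistQ f g μl) * SlabFluxWard.rotQ f g b - SlabFluxWard.rotQ f g b * (SlabFluxWard.diracQ U m₀ + SlabFluxWard.twistQ f g μl) = ∑ x : TorusSite 4 L, (b (x 0 + 1) - b (x 0)) • SlabFluxWard.currQ f g U x + (2 * (μl : ℂ)) • ∑ x : TorusSite 4 L, b (x 0) • SlabFluxWard.densQ f g x :=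
  fun hfg U m₀ μl b => SlabFluxWard.twDirac_comm_rotQ hfg U m₀ μl b


end Summit.QuantumFields.QCD.Cruxes.ChiralCornerSoftness.TwistedRay
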